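import Literature.AlgebraicGeometry.FundamentalGroup.RiemannExistenceNormalReduction
import Literature.AlgebraicGeometry.FundamentalGroup.RiemannExistenceCharPolyIntegral
import HarnessLib

/-!
# Riemann's existence theorem: the one remaining input, for normal affine varieties

Topic `Literature/AlgebraicGeometry/FundamentalGroup`; proof file attached to the named fact
`riemannExistence_finiteCovering` (`RiemannExistenceCovering.lean`, SGA 1 Exp. XII Thm. 5.1 in
covering form: every finite-fibred covering space of `S(ℂ)`, `S` quasi-projective over `ℂ`, is
`S'(ℂ)` for a finite étale `S' → S`). It joins the two algebraic halves of the proof now in the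
tree:

* the REDUCTION TO A NORMAL AFFINE BASE (`RiemannExistenceNormalReduction.lean`,
  `riemannExistence_finiteCovering_of_normal_affine`: `S_red ↪ S`, Zariski-local glueing, and
  descent along conductor squares and two-component squares by Milnor patching — SGA 1 XII 5.1
  proof, part 2 a), with IX 4.7 replaced), and
* the ALGEBRAISATION THEOREMS (`RiemannExistenceCharPoly.lean`, Theorem A: a finite covering whose
  sheets are separated by continuous functions with regular characteristic polynomials is finite
  étale algebraic; `RiemannExistenceCharPolyIntegral.lean`, Theorem B: along a finite covering of
  `S(ℂ)` with `Γ(S, 𝒪_S)` integrally closed, the characteristic polynomial of a continuous function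
  integral over `Γ(S, 𝒪_S)` is a monic regular polynomial),

into

* `riemannExistence_finiteCovering_of_integralSeparating` — **the named fact follows from the
  existence of integral separating functions**: for every affine `ℂ`-scheme `S` of finite type
  with `Γ(S, 𝒪_S)` an integrally closed domain (a normal affine variety), every covering map
  `q : T → S(ℂ)` with finite fibres and every `P₀ ∈ S(ℂ)`, a continuous `h : T → ℂ`, integral over
  `Γ(S, 𝒪_S)` and injective on `q⁻¹(P₀)`.

This existence statement is the transcendental heart of Riemann's existence theorem (holomorphic
functions of polynomial growth separating the sheets of `T`: Grauert–Remmert's extension theorem,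
Serre's GAGA on a projective closure, or Hörmander's `L²` estimates, followed — for singular normal
`S` — by Riemann extension across the singular locus); it is the same input, with «smooth» replaced
by «normal», as in `riemannExistence_qbarDescent_of_finiteIndex_of_integralSeparating`
(`RiemannExistenceQbarDescentProofs.lean`). Nothing transcendental is claimed here; the file is a
two-line combination and introduces no definitions and no named facts.

## References

* [SGA1] A. Grothendieck, M. Raynaud, *Revêtements étales et groupe fondamental (SGA 1)*, LNM 224 /
  arXiv:math/0206203, Exp. XII Thm. 5.1 (p. 333 of the SMF edition; p0184 of the materialised
  text) and its proof, part 2.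
* J.-P. Serre, *Géométrie algébrique et géométrie analytique*, Ann. Inst. Fourier 6 (1956), n° 16
  Lemme 8, n° 19–20. [SerreGAGA1956]

#harness_tags algebraic_geometry.sga1, complex_geometry.riemann_existence, hodge.stub_C1
-/

noncomputable section

open CategoryTheory AlgebraicGeometry Polynomial
open _root_.Topology

namespace Literature.AlgebraicGeometry.FundamentalGroup

open Literature.AlgebraicGeometry.Motives Literature.AlgebraicGeometry.Motives.AlgPoints

/-- **`riemannExistence_finiteCovering` (SGA 1 XII 5.1, covering form) from the existence of
integral separating functions on finite coverings of NORMAL affine varieties.** Combining the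
reduction to the normal affine case (`riemannExistence_finiteCovering_of_normal_affine`: Milnor
patching over conductor and two-component squares, Noetherian induction, nilpotent thickenings,
Zariski-local glueing) with the algebraisation theorems of `RiemannExistenceCharPoly.lean`
(Theorem A: a finite covering whose sheets are separated by continuous functions with REGULAR
characteristic polynomials is finite étale algebraic) and `RiemannExistenceCharPolyIntegral.lean`
(Theorem B: the characteristic polynomial of a continuous function INTEGRAL over the integrally
closed `Γ(S, 𝒪_S)` is regular), the named fact follows from: for every affine `ℂ`-scheme `S` of
finite type with `Γ(S, 𝒪_S)` an integrally closed domain, every covering map `q : T → S(ℂ)` with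
finite fibres and every `P₀ ∈ S(ℂ)`, there is a continuous `h : T → ℂ`, integral over `Γ(S, 𝒪_S)`
(`R(q t)(h t) = 0` for one monic `R`) and injective on the fibre `q⁻¹(P₀)`. This existence statement
(holomorphic functions of polynomial growth on `T` separating the sheets: Grauert–Remmert, GAGA, or
Hörmander's `L²` estimates) is the transcendental heart of Riemann's existence theorem and the one
input that remains for the named fact. [cite: SGA1, Exp. XII Thm. 5.1 (p. 333), proof, part 2] -/
theorem riemannExistence_finiteCovering_of_integralSeparating
    (H : ∀ (S : Motives.SchemeOver ℂ), IsAffine S.left → LocallyOfFiniteType S.hom →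
      IsDomain Γ(S.left, ⊤) → IsIntegrallyClosed Γ(S.left, ⊤) →
      ∀ (T : Type) [TopologicalSpace T] (q : T → Motives.ComplexPoints S) (_ : IsCoveringMap q)
        (_ : ∀ t, (q ⁻¹' {t}).Finite) (P₀ : Motives.ComplexPoints S),
        ∃ (h : T → ℂ) (R : Polynomial Γ(S.left, ⊤)), Continuous h ∧ R.Monic ∧
          (∀ t, (R.map ((q t).evalRingHom ⊤ trivial)).eval (h t) = 0) ∧
          Set.InjOn h (q ⁻¹' {P₀})) :
    riemannExistence_finiteCovering := by
  refine riemannExistence_finiteCovering_of_normal_affine fun S hS hft hdom hic T _ q hq hfin ↦ ?_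
  haveI := hS
  haveI := hft
  haveI := hdom
  haveI : IsSeparated S.hom := inferInstance
  refine CharPoly.exists_finite_etale_homeomorph_of_charPoly_of_isCoveringMap q hq hfin fun P₀ ↦ ?_
  haveI : Nonempty S.left := ⟨P₀.pt⟩
  haveI : IsIntegral S.left := isIntegral_of_isAffine_of_isDomain S.left
  obtain ⟨h, R, hh, hR, hroot, hinj⟩ := H S hS hft hdom hic T q hq hfin P₀
  obtain ⟨Q, hQ, hroots⟩ := CharPolyIntegral.exists_charPoly (X := S) (U := ⊤)
    (isAffineOpen_top S.left) ⟨P₀.pt, trivial⟩ hic hq hfin h hh.continuousOn R hR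
    (fun t _ ↦ hroot t)
  exact ⟨⊤, isAffineOpen_top S.left, trivial, h, Q, hh.continuousOn, hQ, hroots, hinj⟩

end Literature.AlgebraicGeometry.FundamentalGroup

end
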